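import Mathlib
import Summits.ValiantsHypothesis.ValiantsHypothesis.Theorems.BarrierLeverPartitionMinorsHitByVPHiddenStatesJoinLaplace

/-!
# Route BarrierLever — item `PartitionMinorsHitByVP` (stmt-ValiantsHypothesis-19717), line `hidden_states`:
# the Laplace expansion of a join, part 2 — «private WEIGHT TUPLE ⇒ good» (base-`B` digits)

Helper file (`--supports stmt-ValiantsHypothesis-19717`; cell valiant-natproofs, rung V4, line `hidden_states`, node #1;
prover seat val-np-p3 gen 21; memo HOME/val-np-p3/g21/MEMO-bpwindow-valnp3-g21.md §5). Definition-free. Closes NO item.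

`JoinLaplace.join_good_of_private_basePartition` (part 1) asks that the distinguished base-partition `L₀` be alone in its
EXPONENT class `Σ_i lam (L i) · ω(u i)`. With `lam p = B^p` and `B > Σ_i ω(u i)` the exponent determines the weight of EVERY
piece (`weights_eq_of_expo_eq`, base-`B` digits), so it suffices that every other labelling with the same weight tuple
`(Σ_{L i = p} ω(u i))_p` has a block that is a base for no table (`join_good_of_private_weights`). With `ω_a = (r+1)^a` the
weight of a piece determines its PROFILE `Σ_{L i = p} 1_{u i} ∈ ℕ^h`, which is the form used by the censuses (kit j332230:
«UPT», unique profile tuple). WHAT THIS IS NOT: nothing on «union ⇒ good» in general; nothing on crux 14610 or VP ≠ VNP.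
-/

set_option linter.dupNamespace false

namespace Summit.ValiantsHypothesis.ValiantsHypothesis.Theorems.BarrierLever.HiddenStates

open Finset Matrix

noncomputable section

namespace JoinLaplace

open GreedyCut

variable {r m h K : ℕ}

/-! ## 5. Reading the exponent piece by piece (base-`B` digits) -/

/-- With `lam p = B ^ p` and `B` larger than the total weight, equal exponents mean equal weight in EVERY piece. -/
theorem weights_eq_of_expo_eq {B : ℕ} (w : Fin r → ℕ) (hB : ∑ i, w i < B) (L L' : Fin r → Fin m)
    (hexp : ∑ i, B ^ (L i : ℕ) * w i = ∑ i, B ^ (L' i : ℕ) * w i) (p : Fin m) :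
    ∑ i ∈ fiber L p, w i = ∑ i ∈ fiber L' p, w i := by
  classical
  -- write both sides as `Σ_q B^q · W_q` and use uniqueness of base-`B` digits
  have hsplit : ∀ M : Fin r → Fin m, ∑ i, B ^ (M i : ℕ) * w i = ∑ q : Fin m, B ^ (q : ℕ) * ∑ i ∈ fiber M q, w i := by
    intro M
    rw [← Finset.sum_fiberwise_of_maps_to (s := Finset.univ) (t := Finset.univ) (g := M) (fun i _ => Finset.mem_univ _)]
    refine Finset.sum_congr rfl fun q _ => ?_
    rw [Finset.mul_sum]
    refine Finset.sum_congr (by simp [fiber]) fun i hi => ?_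
    rw [mem_fiber.mp hi]
  rw [hsplit L, hsplit L'] at hexp
  have hlt : ∀ M : Fin r → Fin m, ∀ q, ∑ i ∈ fiber M q, w i < B := fun M q =>
    lt_of_le_of_lt (Finset.sum_le_sum_of_subset_of_nonneg (Finset.subset_univ _) fun _ _ _ => Nat.zero_le _) hB
  -- induction-free digit comparison: compare the two expansions modulo `B^(p+1)` and divide by `B^p`
  have key : ∀ (W W' : Fin m → ℕ), (∀ q, W q < B) → (∀ q, W' q < B) →
      ∑ q : Fin m, B ^ (q : ℕ) * W q = ∑ q : Fin m, B ^ (q : ℕ) * W' q → W p = W' p := by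
    intro W W' hW hW' hWW
    have hBpos : 0 < B := lt_of_le_of_lt (Nat.zero_le _) hB
    have hdig : ∀ (V : Fin m → ℕ), (∀ q, V q < B) →
        (∑ q : Fin m, B ^ (q : ℕ) * V q) / B ^ (p : ℕ) % B = V p := by
      intro V hV
      -- split the sum into q < p, q = p, q > p
      have hsum : ∑ q : Fin m, B ^ (q : ℕ) * V q =
          (∑ q ∈ Finset.univ.filter (fun q : Fin m => (q : ℕ) < p), B ^ (q : ℕ) * V q) +
          (B ^ (p : ℕ) * V p + ∑ q ∈ Finset.univ.filter (fun q : Fin m => (p : ℕ) < q), B ^ (q : ℕ) * V q) := by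
        rw [← Finset.sum_filter_add_sum_filter_not Finset.univ (fun q : Fin m => (q : ℕ) < p)]
        congr 1
        have hsplit2 : Finset.univ.filter (fun q : Fin m => ¬ (q : ℕ) < p) =
            insert p (Finset.univ.filter fun q : Fin m => (p : ℕ) < q) := by
          ext q
          simp only [Finset.mem_filter, Finset.mem_univ, true_and, Finset.mem_insert]
          constructor
          · intro hq
            rcases Nat.lt_or_ge (p : ℕ) q with h1 | h1
            · exact Or.inr h1
            · exact Or.inl (Fin.ext (by omega))
          · rintro (rfl | hq) <;> omega
        rw [hsplit2, Finset.sum_insert (by simp)]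
      -- the low part is `< B^p`, the high part is divisible by `B^(p+1)`
      have hlow : ∑ q ∈ Finset.univ.filter (fun q : Fin m => (q : ℕ) < p), B ^ (q : ℕ) * V q < B ^ (p : ℕ) := by
        calc ∑ q ∈ Finset.univ.filter (fun q : Fin m => (q : ℕ) < p), B ^ (q : ℕ) * V q
            ≤ ∑ q ∈ Finset.univ.filter (fun q : Fin m => (q : ℕ) < p), B ^ (q : ℕ) * (B - 1) :=
              Finset.sum_le_sum fun q _ => Nat.mul_le_mul_left _ (by have := hV q; omega)
          _ ≤ ∑ j ∈ Finset.range p, B ^ j * (B - 1) := by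
              -- inject `q ↦ (q : ℕ)` into `range p`
              rw [← Finset.sum_image (f := fun j => B ^ j * (B - 1)) (s := Finset.univ.filter fun q : Fin m => (q : ℕ) < p)
                (g := fun q => (q : ℕ)) (fun x _ y _ hxy => Fin.ext hxy)]
              refine Finset.sum_le_sum_of_subset_of_nonneg ?_ fun _ _ _ => Nat.zero_le _
              intro j hj
              rw [Finset.mem_image] at hj
              obtain ⟨q, hq, rfl⟩ := hj
              rw [Finset.mem_filter] at hq
              exact Finset.mem_range.mpr hq.2
          _ < B ^ (p : ℕ) := by
              have hgeom : ∀ n : ℕ, ∑ j ∈ Finset.range n, B ^ j * (B - 1) + 1 = B ^ n := by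
                intro n
                induction n with
                | zero => simp
                | succ n ih =>
                  rw [Finset.sum_range_succ, add_right_comm, ih, pow_succ]
                  have : B ^ n * (B - 1) + B ^ n = B ^ n * B := by
                    rw [← Nat.mul_succ]; congr 1; omega
                  omega
              have := hgeom p
              omega
      have hhigh : B ^ ((p : ℕ) + 1) ∣ ∑ q ∈ Finset.univ.filter (fun q : Fin m => (p : ℕ) < q), B ^ (q : ℕ) * V q := by
        refine Finset.dvd_sum fun q hq => ?_
        rw [Finset.mem_filter] at hq
        exact Dvd.dvd.mul_right (pow_dvd_pow B hq.2) _
      obtain ⟨Q, hQ⟩ := hhigh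
      rw [hsum, hQ]
      have hBp : 0 < B ^ (p : ℕ) := pow_pos hBpos _
      -- ((low) + (B^p * V p + B^(p+1) * Q)) / B^p = V p + B * Q
      have hdiv : (∑ q ∈ Finset.univ.filter (fun q : Fin m => (q : ℕ) < p), B ^ (q : ℕ) * V q +
          (B ^ (p : ℕ) * V p + B ^ ((p : ℕ) + 1) * Q)) / B ^ (p : ℕ) = V p + B * Q := by
        rw [show B ^ (p : ℕ) * V p + B ^ ((p : ℕ) + 1) * Q = (V p + B * Q) * B ^ (p : ℕ) by ring]
        rw [Nat.add_mul_div_right _ _ hBp, Nat.div_eq_of_lt hlow, zero_add]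
      rw [hdiv, Nat.add_mul_mod_self_left, Nat.mod_eq_of_lt (hV p)]
    have h1 := hdig W hW
    have h2 := hdig W' hW'
    rw [hWW] at h1
    rw [← h1, h2]
  exact key _ _ (hlt L) (hlt L') hexp

/-- **PRIVATE WEIGHT-TUPLE ⇒ GOOD** (the digit form): with `B > Σ_i ω(u i)` and scalings `c^{B^p ω_a}`, it suffices that every
labelling `L ≠ L₀` with the SAME WEIGHT IN EVERY PIECE (`Σ_{L i = p} ω(u i) = Σ_{L₀ i = p} ω(u i)` for all `p`) has a block that is
a base for no table. With `ω_a = (r+1)^a`-type weights «same weight in every piece» is «same profile in every piece». -/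
theorem join_good_of_private_weights (u : Fin r → Finset (Fin h)) (e : Fin r → Fin m × Finset (Fin K))
    (ω : Fin h → ℕ) (B : ℕ) (hB : ∑ i, ∑ a ∈ u i, ω a < B) (L₀ : Fin r → Fin m)
    (hbase : ∀ p, ∃ t : Fin m → Option (Fin K) → Fin h → ℂ, IsBase (joinMat u e t) (fiber (pieceOf e) p) (fiber L₀ p))
    (hpriv : ∀ L : Fin r → Fin m, L ≠ L₀ →
      (∀ p, ∑ i ∈ fiber L p, ∑ a ∈ u i, ω a = ∑ i ∈ fiber L₀ p, ∑ a ∈ u i, ω a) →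
      ∃ p, ∀ t : Fin m → Option (Fin K) → Fin h → ℂ, ¬ IsBase (joinMat u e t) (fiber (pieceOf e) p) (fiber L p)) :
    ∃ tx : Fin m → Option (Fin K) → Fin h → ℂ, (joinMat u e tx).det ≠ 0 :=
  join_good_of_private_basePartition u e (fun p => B ^ (p : ℕ)) ω L₀ hbase fun L hL hexp =>
    hpriv L hL (weights_eq_of_expo_eq (fun i => ∑ a ∈ u i, ω a) hB L L₀ hexp)

end JoinLaplace

end

end Summit.ValiantsHypothesis.ValiantsHypothesis.Theorems.BarrierLever.HiddenStates
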